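import Literature.NumberTheory.GaloisRepresentations.GaloisRep
import HarnessLib

/-!
# Brauer–Taylor descent for `PotentialCompanionDescent.BrauerTaylorDescent` — framing and continuity of the descended representation

Part 3b of the lineage programme (Barnet-Lamb–Gee–Geraghty–Taylor 2014, proof of Thm. 5.5.1:
"`r` … is a continuous representation (continuous because …`r|_{G_{F_j}} ≅ r_j`…)").
The virtual Brauer descent produces an *abstract* representation `W` of `Γ_K` with
`W|_{Hⱼ} ≅ rⱼ` for the continuous framed `rⱼ` on the open subgroups `Hⱼ`.  Here:

* `continuous_of_continuous_comp_subtype`: a homomorphism out of a topological group that is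
  continuous on an open subgroup is continuous;
* `charpoly_eq_of_equiv`: `W|_T ≅ r` (framed) gives `charpoly (W t) = charpoly (r t)`;
* `exists_framedRep_extending`: **framing** — if `W|_S ≅ r` for an open subgroup `S` and a framed
  continuous `r : S →ₜ* GL_n(k)`, there is a framed continuous `ρ : G →ₜ* GL_n(k)` with
  `ρ|_S = r` *pointwise* and `charpoly (ρ g) = charpoly (W g)` for all `g` (transport the frame
  of `r` along the isomorphism).

References: BLGGT, Ann. of Math. 179 (2014), proof of Thm. 5.5.1 (arXiv:1010.2561 Thm. 5.4.1).
-/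

set_option linter.dupNamespace false

noncomputable section

open Literature.NumberTheory.GaloisRepresentations Topology

namespace Summit.Langlands.Langlands.Theorems.BrauerTaylorDescent

/-! ## Continuity from an open subgroup -/

section Continuity

variable {G M : Type} [Group G] [TopologicalSpace G] [IsTopologicalGroup G]
  [Monoid M] [TopologicalSpace M] [ContinuousMul M]

/-- A homomorphism out of a topological group which is continuous on an open subgroup is
continuous. [folklore] -/
theorem continuous_of_continuous_comp_subtype (f : G →* M) (S : Subgroup G)
    (hS : IsOpen (S : Set G)) (hf : Continuous fun s : S => f s) : Continuous f :=
  continuous_of_continuousAt_one f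
    ((continuousOn_iff_continuous_restrict.2 hf).continuousAt (hS.mem_nhds S.one_mem))

end Continuity

/-! ## Characteristic polynomials through an isomorphism with a framed representation -/

section Framing

variable {G : Type} [Group G] [TopologicalSpace G] [IsTopologicalGroup G]
  {k : Type} [Field k] [TopologicalSpace k] [IsTopologicalRing k] {n : ℕ}
  {X : Type} [AddCommGroup X] [Module k X] [FiniteDimensional k X]

omit [IsTopologicalGroup G] [IsTopologicalRing k] in
/-- If `W|_T ≅ r` for a framed `r : T →ₜ* GL_n(k)`, then `charpoly (W t) = charpoly (r t)` for
`t ∈ T`. [folklore] -/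
theorem charpoly_eq_of_equiv (W : Representation k G X) (T : Subgroup G) (r : FramedRep T k n)
    (e : Representation.Equiv (FramedRep.toRepresentation r) (W.comp T.subtype)) (t : T) :
    LinearMap.charpoly (W (t : G)) = FramedRep.charpoly r t := by
  have h1 : W (t : G) = e.conj (FramedRep.toRepresentation r t) :=
    (Representation.Equiv.conj_apply_self t e).symm
  have h2 : FramedRep.toRepresentation r t =
      Matrix.toLin' ((r t : GL (Fin n) k) : Matrix (Fin n) (Fin n) k) :=
    LinearMap.ext fun v => by rw [FramedRep.toRepresentation_apply_apply, Matrix.toLin'_apply]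
  rw [h1, LinearEquiv.charpoly_conj, h2, Matrix.charpoly_toLin', FramedRep.charpoly]

/-- **Framing an abstract representation along `W|_S ≅ r`.**  Let `S ≤ G` be an open subgroup of
a topological group, `r : S →ₜ* GL_n(k)` continuous and framed, and `W` a representation of `G`
on a finite-dimensional `X` with `r ≅ W|_S`.  Then there is a continuous framed
`ρ : G →ₜ* GL_n(k)` with `ρ|_S = r` pointwise and `charpoly (ρ g) = charpoly (W g)` for all
`g ∈ G` (namely `W` in the frame transported from `r`; continuity from the open subgroup `S`).
[cite: BarnetlambEtAl2014, proof of Thm. 5.5.1] -/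
theorem exists_framedRep_extending (W : Representation k G X) (S : Subgroup G)
    (hS : IsOpen (S : Set G)) (r : FramedRep S k n)
    (e : Representation.Equiv (FramedRep.toRepresentation r) (W.comp S.subtype)) :
    ∃ ρ : FramedRep G k n, (∀ s : S, ρ (s : G) = r s) ∧
      ∀ g : G, FramedRep.charpoly ρ g = LinearMap.charpoly (W g) := by
  classical
  let φ : X ≃ₗ[k] (Fin n → k) := e.symm.toLinearEquiv
  let W' : G →* Module.End k (Fin n → k) :=
    { toFun := fun g => φ.conj (W g)
      map_one' := by rw [map_one, Module.End.one_eq_id, LinearEquiv.conj_id]; rfl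
      map_mul' := fun g h => by
        rw [map_mul, Module.End.mul_eq_comp, LinearEquiv.conj_comp, ← Module.End.mul_eq_comp] }
  let ρ₀ : G →* GL (Fin n) k :=
    Matrix.GeneralLinearGroup.toLin.symm.toMonoidHom.comp W'.toHomUnits
  -- the matrix of `ρ₀ g` acts as `φ ∘ W g ∘ φ⁻¹`
  have hlin : ∀ g : G,
      ((Matrix.GeneralLinearGroup.toLin (ρ₀ g) : LinearMap.GeneralLinearGroup k (Fin n → k)) :
        Module.End k (Fin n → k)) = φ.conj (W g) := fun g => by
    show ((Matrix.GeneralLinearGroup.toLin (Matrix.GeneralLinearGroup.toLin.symm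
      (W'.toHomUnits g)) : LinearMap.GeneralLinearGroup k (Fin n → k)) :
        Module.End k (Fin n → k)) = φ.conj (W g)
    rw [MulEquiv.apply_symm_apply]
    rfl
  -- `ρ₀|_S = r`
  have hres : ∀ s : S, ρ₀ (s : G) = r s := fun s => by
    apply Matrix.GeneralLinearGroup.toLin.injective
    ext1
    rw [hlin]
    have h1 : φ.conj (W (s : G)) = FramedRep.toRepresentation r s :=
      Representation.Equiv.conj_apply_self s e.symm
    rw [h1, Matrix.GeneralLinearGroup.coe_toLin]
    exact LinearMap.ext fun v => by
      rw [FramedRep.toRepresentation_apply_apply, Matrix.mulVecLin_apply]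
  -- continuity
  have hcont : Continuous ρ₀ := by
    refine continuous_of_continuous_comp_subtype ρ₀ S hS ?_
    have : (fun s : S => ρ₀ (s : G)) = fun s => r s := funext hres
    rw [this]
    exact map_continuous r
  refine ⟨⟨ρ₀, hcont⟩, hres, fun g => ?_⟩
  -- characteristic polynomials
  have h2 : Matrix.toLin' (((⟨ρ₀, hcont⟩ : FramedRep G k n) g : GL (Fin n) k) :
      Matrix (Fin n) (Fin n) k) = φ.conj (W g) := by
    rw [← hlin g, Matrix.GeneralLinearGroup.coe_toLin]
    rfl
  rw [FramedRep.charpoly, ← Matrix.charpoly_toLin', h2, LinearEquiv.charpoly_conj]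

end Framing

end Summit.Langlands.Langlands.Theorems.BrauerTaylorDescent

end
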